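import Literature.NumberTheory.EllipticCurves.IwasawaNakayamaProofs
import Literature.NumberTheory.EllipticCurves.IwasawaModuleFinitePadicIntProofs
import Literature.NumberTheory.EllipticCurves.IwasawaSelmerDualEisensteinQuotientProofs
import HarnessLib

/-!
# The dual `X(E/K_∞) = Hom(Sel_{p^∞}(E/K_∞), ℚ/ℤ)` of the CLASSICAL Selmer group: `X/(p)X` finite ⟸ `Sel_∞[p]` finite,
# and then **`Λ`-TORSION with `μ = 0`, finitely generated over `ℤ_p`** (Pontryagin algebra + Nakayama, proved; no named fact)

Third instance (after the tree's `KatoFineSelmerDualMuProofs` for the fine Selmer group and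
`GreenbergStrictSelmerDualMuProofs` for Greenberg strict data), WORD FOR WORD, of the residual-finiteness package — now for
the classical `p^∞`-Selmer dual data `WeierstrassCurve.SelmerDualData W κ γ` of `IwasawaSelmer.lean` (the structure on which
`D.IsTorsion`, `D.mu`, `D.lambda` of every `2`-adic lane statement are read):

* `SelmerDualData.finite_quotient_augIdealP_of_finite_pTorsion` — `Sel_{p^∞}(E/K_∞)[p]` finite ⟹ `X/(p)X` finite
  (`IwasawaDual.finite_quotient_pSmul_of_finite_pTorsion` for the datum);
* `.module_finite_of_finite_pTorsion'` — finite generation over `Λ` from `Sel_∞[p]` finite alone (the tree's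
  `SelmerDualData.module_finite_of_finite` asks only for the smaller `Sel_∞[𝔪]`);
* `.isTorsion_of_finite_pTorsion`, `.mu_eq_zero_of_finite_pTorsion`, `.moduleFinite_padicInt_of_finite_pTorsion`,
  `.isTorsion_and_mu_eq_zero_of_finite_pTorsion` — **`Sel_{p^∞}(E/K_∞)[p]` finite ⟹ `X(E/K_∞)` is `Λ`-torsion, `μ = 0`,
  and finitely generated over `ℤ_p`** (tree `isTorsion_of_finite_quotient_augIdealP`,
  `muInvariant_eq_zero_of_finite_quotient_augIdealP`, `moduleFinite_padicInt_of_finite_quotient_augIdealP`).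

USE (why this is filed now; cell `bsd-2adic`, seat `bsd-2adic-t42` GEN 27, road «H514-KERNEL»).  Greenberg, LNM 1716,
Prop. 5.14 (`p = 2`): «We must show that `Sel_E(ℚ_∞)₂[2]` is finite» — and then concludes «`Sel_E(ℚ_∞)₂` is `Λ`-cotorsion and
`μ_E = 0`».  This file is exactly that last implication for the tree's dual data, so that the kernel proof of the named fact
`Greenberg1999.prop514_isTorsion_mu_eq_zero_two` (conclusion `D.IsTorsion ∧ D.mu = 0`) reduces to the residual statement
«`{s ∈ Sel_{2^∞}(E/ℚ_∞) | 2 • s = 0}` is finite».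

HONEST FRAMING: theorems only; nothing asserted about any particular Selmer group; BSD is not proved by any of this.

References: R. Greenberg, LNM 1716 (1999), §1 p. 60 ("`X/𝔪X` is finite … Nakayama"), §5 Prop. 5.14 (proof, first sentence)
[GreenbergLNM1716]; L. Washington, *Introduction to Cyclotomic Fields*, §13.2 [Washington1997]; S. Lang, *Cyclotomic Fields
I and II*, Ch. 5 §1.
-/

noncomputable section

open scoped Classical

open Literature.NumberTheory.EllipticCurves Literature.NumberTheory.EllipticCurves.IwasawaAlgebra
  Literature.NumberTheory.EllipticCurves.IwasawaModuleFinitePadicInt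
  Literature.NumberTheory.EllipticCurves.IwasawaDual

universe u

namespace WeierstrassCurve

namespace SelmerDualData

variable {K : Type u} [Field K] [NumberField K] {W : WeierstrassCurve K} {p : ℕ} [Fact p.Prime]
  {κ : ZpExtension K p} {γ : Field.absoluteGaloisGroup K} (D : W.SelmerDualData κ γ)

/-- **`X(E/K_∞)` is finitely generated over `Λ` once `Sel_{p^∞}(E/K_∞)[p]` is finite** (the tree's
`SelmerDualData.module_finite_of_finite` needs only the finiteness of `Sel_∞[𝔪] ⊆ Sel_∞[p]`).
[cite: GreenbergLNM1716, §1 p. 60 (after Conj. 1.3)] -/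
theorem module_finite_of_finite_pTorsion' (hγ : κ.IsTopGenerator γ)
    (hfin : Set.Finite {s : W.selmerInfty κ | p • s = 0}) :
    Module.Finite (IwasawaAlgebra p) D.X :=
  D.module_finite_of_finite W hγ (hfin.subset fun _ hs ↦ hs.1)

/-- **`Sel_{p^∞}(E/K_∞)[p]` finite ⟹ `X/(p)X` finite** (`IwasawaDual.finite_quotient_pSmul_of_finite_pTorsion` for the
datum `D`; `(p) = augIdealP p`). [cite: GreenbergLNM1716, §1 p. 60 (after Conj. 1.3)] -/
theorem finite_quotient_augIdealP_of_finite_pTorsion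
    (hfin : Set.Finite {s : W.selmerInfty κ | p • s = 0}) :
    Finite (D.X ⧸ (IwasawaAlgebra.augIdealP p • (⊤ : Submodule (IwasawaAlgebra p) D.X))) :=
  IwasawaDual.finite_quotient_pSmul_of_finite_pTorsion D.bijective D.toDual_C_smul
    exists_pow_smul_selmerInfty_eq_zero hfin

/-- **`Sel_{p^∞}(E/K_∞)[p]` finite ⟹ `X(E/K_∞)` is `Λ`-TORSION** (`D.IsTorsion`): finite generation by Nakayama, then
the tree's `isTorsion_of_finite_quotient_augIdealP`. [cite: GreenbergLNM1716, §1 p. 60 and §5 Prop. 5.14 (proof)]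
[cite: Washington1997, §13.2] -/
theorem isTorsion_of_finite_pTorsion (hγ : κ.IsTopGenerator γ)
    (hfin : Set.Finite {s : W.selmerInfty κ | p • s = 0}) : D.IsTorsion := by
  haveI := D.module_finite_of_finite_pTorsion' hγ hfin
  exact isTorsion_of_finite_quotient_augIdealP p D.X (D.finite_quotient_augIdealP_of_finite_pTorsion hfin)

/-- **`Sel_{p^∞}(E/K_∞)[p]` finite ⟹ `μ(X(E/K_∞)) = 0`** (`D.mu = 0`; tree `muInvariant_eq_zero_of_finite_quotient_augIdealP`).
[cite: GreenbergLNM1716, §1 p. 60 and §5 Prop. 5.14 (proof)] [cite: Washington1997, §13.2] -/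
theorem mu_eq_zero_of_finite_pTorsion (hγ : κ.IsTopGenerator γ)
    (hfin : Set.Finite {s : W.selmerInfty κ | p • s = 0}) : D.mu = 0 := by
  haveI := D.module_finite_of_finite_pTorsion' hγ hfin
  exact muInvariant_eq_zero_of_finite_quotient_augIdealP p D.X (D.isTorsion_of_finite_pTorsion hγ hfin)
    (D.finite_quotient_augIdealP_of_finite_pTorsion hfin)

/-- **`Sel_{p^∞}(E/K_∞)[p]` finite ⟹ `X(E/K_∞)` is finitely generated over `ℤ_p`** (tree
`moduleFinite_padicInt_of_finite_quotient_augIdealP`). [cite: GreenbergLNM1716, §1 p. 60] [cite: Washington1997, §13.2] -/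
theorem moduleFinite_padicInt_of_finite_pTorsion (hγ : κ.IsTopGenerator γ)
    (hfin : Set.Finite {s : W.selmerInfty κ | p • s = 0}) :
    Module.Finite ℤ_[p] (RestrictScalars ℤ_[p] (IwasawaAlgebra p) D.X) := by
  haveI := D.module_finite_of_finite_pTorsion' hγ hfin
  exact moduleFinite_padicInt_of_finite_quotient_augIdealP p D.X (D.finite_quotient_augIdealP_of_finite_pTorsion hfin)

/-- **The residual-finiteness package for the classical Selmer dual** — the form the `2`-adic lane statements consume
(`D.IsTorsion ∧ D.mu = 0`, e.g. the conclusion of `Greenberg1999.prop514_isTorsion_mu_eq_zero_two`):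
`Sel_{p^∞}(E/K_∞)[p]` finite ⟹ `D.IsTorsion ∧ D.mu = 0`. [cite: GreenbergLNM1716, §5 Prop. 5.14 (proof, first sentence) and §1 p. 60] -/
theorem isTorsion_and_mu_eq_zero_of_finite_pTorsion (hγ : κ.IsTopGenerator γ)
    (hfin : Set.Finite {s : W.selmerInfty κ | p • s = 0}) : D.IsTorsion ∧ D.mu = 0 :=
  ⟨D.isTorsion_of_finite_pTorsion hγ hfin, D.mu_eq_zero_of_finite_pTorsion hγ hfin⟩

end SelmerDualData

end WeierstrassCurve

end
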